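import Summits.Parity.GeneralizedHardyLittlewood.Theorems.PrimeLevelFamEdgeMomentsBeyondDiagonalDiagDecorOrderRungTwoHecke
import Summits.Parity.GeneralizedHardyLittlewood.Theorems.PrimeLevelFamEdgeMomentsBeyondDiagonalDiagDecorOrderOneOneSplit
import HarnessLib

/-!
# Route `PrimeLevelFamEdge`, crux K_A `MomentsBeyondDiagonal` (stmt-Parity-20007), line «petersson_layers» v4, stub `stub_diag`:
# **ORDER `(2,2)` (the second half of rung `N = 2`): the exact Hecke-summed Selberg form and its exact
# polynomial/remainder split** — the order-`(2,2)` twin of `…DiagDecorOrderZeroTwoAssembly.selbergOrderZeroTwo_hecke_eq/_split`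
# (p827655) and `…DiagDecorOrderOneOneHecke/Split` (p825764, p825840)

By `…DiagOrderSymm.subDiag_of_selbergOrderAsymptotics_of_le` rung 2 of `stub_diag` = orders `(0,2)` and `(2,2)`. For
`(2,2)` the Hecke-summed weight is (`…DiagDecorOrderRungTwoHecke.heckeSum_orderTwoTwo_eq`, squarefree `k₁,k₂`)
`ττ·{(L⁴ − 2L²S₂ + 3S₂² − 2S₄)/16·c₀₀ + (L³ − LS₂)/4·(c₀₁ + c₁₀) + (L² + S₂)/4·(c₀₂ + c₂₀) + (L² − S₂)·c₁₁ + L·(c₁₂ + c₂₁) + c₂₂}`,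
`L = 2(log Q − log g) − log k₁ − log k₂`, `S₂ = P₂(k₁)+P₂(k₂)`, `S₄ = P₄(k₁)+P₄(k₂)`, `P_m(k) = Σ_{p∣k}log^m p`,
`c_ab = c_ab(g²k₁k₂/Q²)` the nine Bose coefficients `∫₀^∞ log^a u₁ ∫_{y/u₁}^∞ K(u₁+u₂) log^b u₂` (`K(u) = e^{−u}/(1−e^{−u})²`).
By `…DiagBoseMixedStructure.bose_coeff_structure` (`μ₀ = 1/4`, `μ_k = ∫₀¹log^k v·v/(1+v²)²dv`, odd-`(i+j)` terms vanish)
the polynomial parts are (`Λ = log(1/y)`)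
`Π₀₀ = Λ/2 + E₀₀`, `Π₀₁ = Π₁₀ = −Λ²/8 + E`, `Π₀₂ = Π₂₀ = Λ³/24 + 2μ₂Λ + E`, `Π₁₁ = Λ³/24 − 2μ₂Λ + E₁₁`,
`Π₁₂ = Π₂₁ = −Λ⁴/64 + (μ₂/2)Λ² + E`, `Π₂₂ = Λ⁵/160 − (μ₂/3)Λ³ + 2μ₄Λ + E₂₂` (one free constant `E_ab` per coefficient).
Substituting and collecting (checked by machine, exact rational arithmetic) the polynomial part of the order-`(2,2)` weight is
the sum of TWENTY monomials in the five decoration families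
`ττ·L^m` (`m ≤ 5`), `τP₂(k₁)·τ·L^m` and `τ·τP₂(k₂)·L^m` (`m ≤ 3`), `τP₂(k₁)·τP₂(k₂)·L^m` (`m ≤ 1`) and the NEW
`τ(3P₂² − 2P₄)(k₁)·τ·L^m`, `τ·τ(3P₂² − 2P₄)(k₂)·L^m` (`m ≤ 1`; `τ(3P₂²−2P₄) = M₄`, the fourth central divisor-log
moment of `…DiagDecorWeightRungTwo`), with top-degree part `ττ[L⁵/160 − L³S₂/48 + (3S₂² − 2S₄)L/32]`:

* `selbergOrderTwoTwo_hecke_eq` — the exact Hecke-summed form of the order-`(2,2)` decorated Selberg sum (`Q > 0`);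
* `selbergOrderTwoTwo_split` — `Sel(total) = Sel(poly) + Sel(rem)`, `poly` in the engine format of
  `…DiagDecorShiftedLpow/P2Lpow/P2P2Lpow` (`L = 2λlog M − 2log g − log k₁ − log k₂`, `log Q = λ log M`), `rem` the same
  weight with every `c_ab(y)` replaced by `c_ab(y) − Π_ab(log(Q²/(g²k₁k₂)))`.

Pure algebra (no estimate is claimed here): the order-`(2,2)` TARGET needs, besides these identities, the polynomial
asymptotic (engines landed for the first four families; the `M₄`-family needs a new one) and the remainder estimate (R₂₂).
Def-free; theorems only. Helper `--supports stmt-Parity-20007`; closes nothing; K_A, K_B and the Parity summit are NOT proved;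
nothing about Landau–Siegel zeros.

## References
* E. Kowalski, P. Michel, J. VanderKam, J. reine angew. Math. 526 (2000), (23)–(28) pp. 13–15 and Prop. 5.1 p. 18.
  [cite: KowalskiMichelVanderKam2000, (23)–(28) — derivation (order-(2,2) piece of the diagonal main term, general Q)]
-/

noncomputable section

open scoped Real ArithmeticFunction.Moebius
open Finset ArithmeticFunction Polynomial MeasureTheory Set

namespace Summit.Parity.GeneralizedHardyLittlewood.Theorems.MomentsBeyondDiagonal.DiagKernel

open Literature.NumberTheory.LFunctions Literature.NumberTheory.LFunctions.KMV2000

/-- **The order-`(2,2)` decorated Selberg form after the Hecke summation, exactly** (`Q > 0`, any `M`, `N`):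
`Sel₂₂ = Sel(ττ·{(L⁴ − 2L²S₂ + 3S₂² − 2S₄)/16·c₀₀ + (L³ − LS₂)/4·(c₀₁+c₁₀) + (L²+S₂)/4·(c₀₂+c₂₀) + (L²−S₂)c₁₁
+ L(c₁₂+c₂₁) + c₂₂})`
(`…DiagDecorOrderRungTwoHecke.heckeSum_orderTwoTwo_eq` inside the form; only squarefree `k₁, k₂` count).
[cite: KowalskiMichelVanderKam2000, (23)–(28) — derivation] -/
theorem selbergOrderTwoTwo_hecke_eq (P : ℝ[X]) (M : ℝ) (N : ℕ) {Q : ℝ} (hQ : 0 < Q) :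
    ∑ c ∈ Icc 1 N, ∑ g ∈ Icc 1 (N / c), (μ g : ℝ) * c *
        ∑ k₁ ∈ Icc 1 (N / (c * g)), ∑ k₂ ∈ Icc 1 (N / (c * g)),
          ((μ (c * g * k₁) : ℝ) * ((psi (c * g * k₁))⁻¹ *
              P.eval (Real.log (M / ((c * g * k₁ : ℕ) : ℝ)) / Real.log M)) / ((c * g * k₁ : ℕ) : ℝ)) *
            ((μ (c * g * k₂) : ℝ) * ((psi (c * g * k₂))⁻¹ *
              P.eval (Real.log (M / ((c * g * k₂ : ℕ) : ℝ)) / Real.log M)) / ((c * g * k₂ : ℕ) : ℝ)) *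
            (∑ d ∈ k₁.divisors, ∑ e ∈ k₂.divisors,
              ∫ u₁ in Ioi (0 : ℝ),
                (Real.log (Q / ((k₁ / d * (g * e) : ℕ) : ℝ)) + Real.log u₁) ^ 2 *
                ∫ u₂ in Ioi ((((k₁ / d * (g * e) * (g * d * (k₂ / e)) : ℕ) : ℝ) / Q ^ 2) / u₁),
                  Real.exp (-(u₁ + u₂)) / (1 - Real.exp (-(u₁ + u₂))) ^ 2 *
                  (Real.log (Q / ((g * d * (k₂ / e) : ℕ) : ℝ)) + Real.log u₂) ^ 2) =
      ∑ c ∈ Icc 1 N, ∑ g ∈ Icc 1 (N / c), (μ g : ℝ) * c *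
        ∑ k₁ ∈ Icc 1 (N / (c * g)), ∑ k₂ ∈ Icc 1 (N / (c * g)),
          ((μ (c * g * k₁) : ℝ) * ((psi (c * g * k₁))⁻¹ *
              P.eval (Real.log (M / ((c * g * k₁ : ℕ) : ℝ)) / Real.log M)) / ((c * g * k₁ : ℕ) : ℝ)) *
            ((μ (c * g * k₂) : ℝ) * ((psi (c * g * k₂))⁻¹ *
              P.eval (Real.log (M / ((c * g * k₂ : ℕ) : ℝ)) / Real.log M)) / ((c * g * k₂ : ℕ) : ℝ)) *
            ((k₁.divisors.card : ℝ) * (k₂.divisors.card : ℝ) *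
              (((2 * (Real.log Q - Real.log g) - Real.log k₁ - Real.log k₂) ^ 4 -
                    2 * (2 * (Real.log Q - Real.log g) - Real.log k₁ - Real.log k₂) ^ 2 *
                      ((∑ p ∈ k₁.primeFactors, Real.log p ^ 2) + ∑ p ∈ k₂.primeFactors, Real.log p ^ 2) +
                    3 * ((∑ p ∈ k₁.primeFactors, Real.log p ^ 2) + ∑ p ∈ k₂.primeFactors, Real.log p ^ 2) ^ 2 -
                    2 * ((∑ p ∈ k₁.primeFactors, Real.log p ^ 4) + ∑ p ∈ k₂.primeFactors, Real.log p ^ 4)) / 16 *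
                  (∫ u₁ in Ioi (0 : ℝ), ∫ u₂ in Ioi ((((g * g * (k₁ * k₂) : ℕ) : ℝ) / Q ^ 2) / u₁),
              Real.exp (-(u₁ + u₂)) / (1 - Real.exp (-(u₁ + u₂))) ^ 2) +
                ((2 * (Real.log Q - Real.log g) - Real.log k₁ - Real.log k₂) ^ 3 -
                    (2 * (Real.log Q - Real.log g) - Real.log k₁ - Real.log k₂) *
                      ((∑ p ∈ k₁.primeFactors, Real.log p ^ 2) + ∑ p ∈ k₂.primeFactors, Real.log p ^ 2)) / 4 *
                  ((∫ u₁ in Ioi (0 : ℝ), ∫ u₂ in Ioi ((((g * g * (k₁ * k₂) : ℕ) : ℝ) / Q ^ 2) / u₁),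
              Real.exp (-(u₁ + u₂)) / (1 - Real.exp (-(u₁ + u₂))) ^ 2 * Real.log u₂) +
                    (∫ u₁ in Ioi (0 : ℝ), Real.log u₁ * ∫ u₂ in Ioi ((((g * g * (k₁ * k₂) : ℕ) : ℝ) / Q ^ 2) / u₁),
              Real.exp (-(u₁ + u₂)) / (1 - Real.exp (-(u₁ + u₂))) ^ 2)) +
                ((2 * (Real.log Q - Real.log g) - Real.log k₁ - Real.log k₂) ^ 2 +
                    ((∑ p ∈ k₁.primeFactors, Real.log p ^ 2) + ∑ p ∈ k₂.primeFactors, Real.log p ^ 2)) / 4 *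
                  ((∫ u₁ in Ioi (0 : ℝ), ∫ u₂ in Ioi ((((g * g * (k₁ * k₂) : ℕ) : ℝ) / Q ^ 2) / u₁),
              Real.exp (-(u₁ + u₂)) / (1 - Real.exp (-(u₁ + u₂))) ^ 2 * Real.log u₂ ^ 2) +
                    (∫ u₁ in Ioi (0 : ℝ), Real.log u₁ ^ 2 * ∫ u₂ in Ioi ((((g * g * (k₁ * k₂) : ℕ) : ℝ) / Q ^ 2) / u₁),
              Real.exp (-(u₁ + u₂)) / (1 - Real.exp (-(u₁ + u₂))) ^ 2)) +
                ((2 * (Real.log Q - Real.log g) - Real.log k₁ - Real.log k₂) ^ 2 -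
                    ((∑ p ∈ k₁.primeFactors, Real.log p ^ 2) + ∑ p ∈ k₂.primeFactors, Real.log p ^ 2)) *
                  (∫ u₁ in Ioi (0 : ℝ), Real.log u₁ * ∫ u₂ in Ioi ((((g * g * (k₁ * k₂) : ℕ) : ℝ) / Q ^ 2) / u₁),
              Real.exp (-(u₁ + u₂)) / (1 - Real.exp (-(u₁ + u₂))) ^ 2 * Real.log u₂) +
                (2 * (Real.log Q - Real.log g) - Real.log k₁ - Real.log k₂) *
                  ((∫ u₁ in Ioi (0 : ℝ), Real.log u₁ * ∫ u₂ in Ioi ((((g * g * (k₁ * k₂) : ℕ) : ℝ) / Q ^ 2) / u₁),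
              Real.exp (-(u₁ + u₂)) / (1 - Real.exp (-(u₁ + u₂))) ^ 2 * Real.log u₂ ^ 2) +
                    (∫ u₁ in Ioi (0 : ℝ), Real.log u₁ ^ 2 * ∫ u₂ in Ioi ((((g * g * (k₁ * k₂) : ℕ) : ℝ) / Q ^ 2) / u₁),
              Real.exp (-(u₁ + u₂)) / (1 - Real.exp (-(u₁ + u₂))) ^ 2 * Real.log u₂)) +
                (∫ u₁ in Ioi (0 : ℝ), Real.log u₁ ^ 2 * ∫ u₂ in Ioi ((((g * g * (k₁ * k₂) : ℕ) : ℝ) / Q ^ 2) / u₁),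
              Real.exp (-(u₁ + u₂)) / (1 - Real.exp (-(u₁ + u₂))) ^ 2 * Real.log u₂ ^ 2))) := by
  rw [selbergForm_congr_squarefree P M N
    (fun c g k₁ k₂ ↦ ∑ d ∈ k₁.divisors, ∑ e ∈ k₂.divisors,
              ∫ u₁ in Ioi (0 : ℝ),
                (Real.log (Q / ((k₁ / d * (g * e) : ℕ) : ℝ)) + Real.log u₁) ^ 2 *
                ∫ u₂ in Ioi ((((k₁ / d * (g * e) * (g * d * (k₂ / e)) : ℕ) : ℝ) / Q ^ 2) / u₁),
                  Real.exp (-(u₁ + u₂)) / (1 - Real.exp (-(u₁ + u₂))) ^ 2 *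
                  (Real.log (Q / ((g * d * (k₂ / e) : ℕ) : ℝ)) + Real.log u₂) ^ 2)
    (fun c g k₁ k₂ ↦ if g = 0 then ∑ d ∈ k₁.divisors, ∑ e ∈ k₂.divisors,
              ∫ u₁ in Ioi (0 : ℝ),
                (Real.log (Q / ((k₁ / d * (g * e) : ℕ) : ℝ)) + Real.log u₁) ^ 2 *
                ∫ u₂ in Ioi ((((k₁ / d * (g * e) * (g * d * (k₂ / e)) : ℕ) : ℝ) / Q ^ 2) / u₁),
                  Real.exp (-(u₁ + u₂)) / (1 - Real.exp (-(u₁ + u₂))) ^ 2 *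
                  (Real.log (Q / ((g * d * (k₂ / e) : ℕ) : ℝ)) + Real.log u₂) ^ 2 else
      ((k₁.divisors.card : ℝ) * (k₂.divisors.card : ℝ) *
              (((2 * (Real.log Q - Real.log g) - Real.log k₁ - Real.log k₂) ^ 4 -
                    2 * (2 * (Real.log Q - Real.log g) - Real.log k₁ - Real.log k₂) ^ 2 *
                      ((∑ p ∈ k₁.primeFactors, Real.log p ^ 2) + ∑ p ∈ k₂.primeFactors, Real.log p ^ 2) +
                    3 * ((∑ p ∈ k₁.primeFactors, Real.log p ^ 2) + ∑ p ∈ k₂.primeFactors, Real.log p ^ 2) ^ 2 -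
                    2 * ((∑ p ∈ k₁.primeFactors, Real.log p ^ 4) + ∑ p ∈ k₂.primeFactors, Real.log p ^ 4)) / 16 *
                  (∫ u₁ in Ioi (0 : ℝ), ∫ u₂ in Ioi ((((g * g * (k₁ * k₂) : ℕ) : ℝ) / Q ^ 2) / u₁),
              Real.exp (-(u₁ + u₂)) / (1 - Real.exp (-(u₁ + u₂))) ^ 2) +
                ((2 * (Real.log Q - Real.log g) - Real.log k₁ - Real.log k₂) ^ 3 -
                    (2 * (Real.log Q - Real.log g) - Real.log k₁ - Real.log k₂) *
                      ((∑ p ∈ k₁.primeFactors, Real.log p ^ 2) + ∑ p ∈ k₂.primeFactors, Real.log p ^ 2)) / 4 *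
                  ((∫ u₁ in Ioi (0 : ℝ), ∫ u₂ in Ioi ((((g * g * (k₁ * k₂) : ℕ) : ℝ) / Q ^ 2) / u₁),
              Real.exp (-(u₁ + u₂)) / (1 - Real.exp (-(u₁ + u₂))) ^ 2 * Real.log u₂) +
                    (∫ u₁ in Ioi (0 : ℝ), Real.log u₁ * ∫ u₂ in Ioi ((((g * g * (k₁ * k₂) : ℕ) : ℝ) / Q ^ 2) / u₁),
              Real.exp (-(u₁ + u₂)) / (1 - Real.exp (-(u₁ + u₂))) ^ 2)) +
                ((2 * (Real.log Q - Real.log g) - Real.log k₁ - Real.log k₂) ^ 2 +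
                    ((∑ p ∈ k₁.primeFactors, Real.log p ^ 2) + ∑ p ∈ k₂.primeFactors, Real.log p ^ 2)) / 4 *
                  ((∫ u₁ in Ioi (0 : ℝ), ∫ u₂ in Ioi ((((g * g * (k₁ * k₂) : ℕ) : ℝ) / Q ^ 2) / u₁),
              Real.exp (-(u₁ + u₂)) / (1 - Real.exp (-(u₁ + u₂))) ^ 2 * Real.log u₂ ^ 2) +
                    (∫ u₁ in Ioi (0 : ℝ), Real.log u₁ ^ 2 * ∫ u₂ in Ioi ((((g * g * (k₁ * k₂) : ℕ) : ℝ) / Q ^ 2) / u₁),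
              Real.exp (-(u₁ + u₂)) / (1 - Real.exp (-(u₁ + u₂))) ^ 2)) +
                ((2 * (Real.log Q - Real.log g) - Real.log k₁ - Real.log k₂) ^ 2 -
                    ((∑ p ∈ k₁.primeFactors, Real.log p ^ 2) + ∑ p ∈ k₂.primeFactors, Real.log p ^ 2)) *
                  (∫ u₁ in Ioi (0 : ℝ), Real.log u₁ * ∫ u₂ in Ioi ((((g * g * (k₁ * k₂) : ℕ) : ℝ) / Q ^ 2) / u₁),
              Real.exp (-(u₁ + u₂)) / (1 - Real.exp (-(u₁ + u₂))) ^ 2 * Real.log u₂) +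
                (2 * (Real.log Q - Real.log g) - Real.log k₁ - Real.log k₂) *
                  ((∫ u₁ in Ioi (0 : ℝ), Real.log u₁ * ∫ u₂ in Ioi ((((g * g * (k₁ * k₂) : ℕ) : ℝ) / Q ^ 2) / u₁),
              Real.exp (-(u₁ + u₂)) / (1 - Real.exp (-(u₁ + u₂))) ^ 2 * Real.log u₂ ^ 2) +
                    (∫ u₁ in Ioi (0 : ℝ), Real.log u₁ ^ 2 * ∫ u₂ in Ioi ((((g * g * (k₁ * k₂) : ℕ) : ℝ) / Q ^ 2) / u₁),
              Real.exp (-(u₁ + u₂)) / (1 - Real.exp (-(u₁ + u₂))) ^ 2 * Real.log u₂)) +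
                (∫ u₁ in Ioi (0 : ℝ), Real.log u₁ ^ 2 * ∫ u₂ in Ioi ((((g * g * (k₁ * k₂) : ℕ) : ℝ) / Q ^ 2) / u₁),
              Real.exp (-(u₁ + u₂)) / (1 - Real.exp (-(u₁ + u₂))) ^ 2 * Real.log u₂ ^ 2))))
    (fun c g k₁ k₂ h₁ h₂ ↦ by
      by_cases hg : g = 0
      · simp only [hg, if_true]
      · simp only [hg, if_false]
        exact heckeSum_orderTwoTwo_eq hQ hg h₁ h₂)]
  refine Finset.sum_congr rfl fun c _ ↦ Finset.sum_congr rfl fun g hg ↦ ?_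
  have hg0 : g ≠ 0 := by have := (Finset.mem_Icc.1 hg).1; omega
  simp only [hg0, if_false]

set_option maxHeartbeats 1000000 in
-- one large `ring` normalisation (twenty monomials, nine abstract Bose coefficients)
/-- **The exact polynomial/remainder split of the order-`(2,2)` Hecke-summed Selberg form** (`Q > 0`,
`log Q = λ·log M`, any reals `E₀₀ E₀₁ E₁₀ E₀₂ E₂₀ E₁₁ E₁₂ E₂₁ E₂₂ μ₂ μ₄`, any functions `c₀₀ … c₂₂`; the `Π_ab` of the module
docstring): `Sel(total) = Sel(poly) + Sel(rem)`, `poly` the twenty monomials in engine format.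
[cite: KowalskiMichelVanderKam2000, (23)–(28) — derivation] -/
theorem selbergOrderTwoTwo_split (P : ℝ[X]) (M : ℝ) {Q lam : ℝ} (hQ : 0 < Q) (hlam : Real.log Q = lam * Real.log M)
    (c₀₀ c₀₁ c₁₀ c₀₂ c₂₀ c₁₁ c₁₂ c₂₁ c₂₂ : ℝ → ℝ) (E₀₀ E₀₁ E₁₀ E₀₂ E₂₀ E₁₁ E₁₂ E₂₁ E₂₂ μ₂ μ₄ : ℝ) :
    ∑ c ∈ Icc 1 ⌊M⌋₊, ∑ g ∈ Icc 1 (⌊M⌋₊ / c), (μ g : ℝ) * c *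
        ∑ k₁ ∈ Icc 1 (⌊M⌋₊ / (c * g)), ∑ k₂ ∈ Icc 1 (⌊M⌋₊ / (c * g)),
          ((μ (c * g * k₁) : ℝ) * ((psi (c * g * k₁))⁻¹ *
              P.eval (Real.log (M / ((c * g * k₁ : ℕ) : ℝ)) / Real.log M)) / ((c * g * k₁ : ℕ) : ℝ)) *
            ((μ (c * g * k₂) : ℝ) * ((psi (c * g * k₂))⁻¹ *
              P.eval (Real.log (M / ((c * g * k₂ : ℕ) : ℝ)) / Real.log M)) / ((c * g * k₂ : ℕ) : ℝ)) *
            ((k₁.divisors.card : ℝ) * (k₂.divisors.card : ℝ) *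
              (((2 * (Real.log Q - Real.log g) - Real.log k₁ - Real.log k₂) ^ 4 -
                    2 * (2 * (Real.log Q - Real.log g) - Real.log k₁ - Real.log k₂) ^ 2 *
                      ((∑ p ∈ k₁.primeFactors, Real.log p ^ 2) + ∑ p ∈ k₂.primeFactors, Real.log p ^ 2) +
                    3 * ((∑ p ∈ k₁.primeFactors, Real.log p ^ 2) + ∑ p ∈ k₂.primeFactors, Real.log p ^ 2) ^ 2 -
                    2 * ((∑ p ∈ k₁.primeFactors, Real.log p ^ 4) + ∑ p ∈ k₂.primeFactors, Real.log p ^ 4)) / 16 *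
                  c₀₀ (((g * g * (k₁ * k₂) : ℕ) : ℝ) / Q ^ 2) +
                ((2 * (Real.log Q - Real.log g) - Real.log k₁ - Real.log k₂) ^ 3 -
                    (2 * (Real.log Q - Real.log g) - Real.log k₁ - Real.log k₂) *
                      ((∑ p ∈ k₁.primeFactors, Real.log p ^ 2) + ∑ p ∈ k₂.primeFactors, Real.log p ^ 2)) / 4 *
                  (c₀₁ (((g * g * (k₁ * k₂) : ℕ) : ℝ) / Q ^ 2) +
                    c₁₀ (((g * g * (k₁ * k₂) : ℕ) : ℝ) / Q ^ 2)) +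
                ((2 * (Real.log Q - Real.log g) - Real.log k₁ - Real.log k₂) ^ 2 +
                    ((∑ p ∈ k₁.primeFactors, Real.log p ^ 2) + ∑ p ∈ k₂.primeFactors, Real.log p ^ 2)) / 4 *
                  (c₀₂ (((g * g * (k₁ * k₂) : ℕ) : ℝ) / Q ^ 2) +
                    c₂₀ (((g * g * (k₁ * k₂) : ℕ) : ℝ) / Q ^ 2)) +
                ((2 * (Real.log Q - Real.log g) - Real.log k₁ - Real.log k₂) ^ 2 -
                    ((∑ p ∈ k₁.primeFactors, Real.log p ^ 2) + ∑ p ∈ k₂.primeFactors, Real.log p ^ 2)) *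
                  c₁₁ (((g * g * (k₁ * k₂) : ℕ) : ℝ) / Q ^ 2) +
                (2 * (Real.log Q - Real.log g) - Real.log k₁ - Real.log k₂) *
                  (c₁₂ (((g * g * (k₁ * k₂) : ℕ) : ℝ) / Q ^ 2) +
                    c₂₁ (((g * g * (k₁ * k₂) : ℕ) : ℝ) / Q ^ 2)) +
                c₂₂ (((g * g * (k₁ * k₂) : ℕ) : ℝ) / Q ^ 2))) =
      ∑ c ∈ Icc 1 ⌊M⌋₊, ∑ g ∈ Icc 1 (⌊M⌋₊ / c), (μ g : ℝ) * c *
        ∑ k₁ ∈ Icc 1 (⌊M⌋₊ / (c * g)), ∑ k₂ ∈ Icc 1 (⌊M⌋₊ / (c * g)),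
          ((μ (c * g * k₁) : ℝ) * ((psi (c * g * k₁))⁻¹ *
              P.eval (Real.log (M / ((c * g * k₁ : ℕ) : ℝ)) / Real.log M)) / ((c * g * k₁ : ℕ) : ℝ)) *
            ((μ (c * g * k₂) : ℝ) * ((psi (c * g * k₂))⁻¹ *
              P.eval (Real.log (M / ((c * g * k₂ : ℕ) : ℝ)) / Real.log M)) / ((c * g * k₂ : ℕ) : ℝ)) *
            (1 / 160 * ((k₁.divisors.card : ℝ) * (k₂.divisors.card : ℝ) *
                (2 * (lam * Real.log M) - 2 * Real.log g - Real.log k₁ - Real.log k₂) ^ 5) +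
              E₀₀ / 16 * ((k₁.divisors.card : ℝ) * (k₂.divisors.card : ℝ) *
                (2 * (lam * Real.log M) - 2 * Real.log g - Real.log k₁ - Real.log k₂) ^ 4) +
              ((E₀₁ + E₁₀) / 4 - μ₂ / 3) * ((k₁.divisors.card : ℝ) * (k₂.divisors.card : ℝ) *
                (2 * (lam * Real.log M) - 2 * Real.log g - Real.log k₁ - Real.log k₂) ^ 3) +
              ((E₀₂ + E₂₀) / 4 + E₁₁) * ((k₁.divisors.card : ℝ) * (k₂.divisors.card : ℝ) *
                (2 * (lam * Real.log M) - 2 * Real.log g - Real.log k₁ - Real.log k₂) ^ 2) +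
              (2 * μ₄ + E₁₂ + E₂₁) * ((k₁.divisors.card : ℝ) * (k₂.divisors.card : ℝ) *
                (2 * (lam * Real.log M) - 2 * Real.log g - Real.log k₁ - Real.log k₂) ^ 1) +
              E₂₂ * ((k₁.divisors.card : ℝ) * (k₂.divisors.card : ℝ) *
                (2 * (lam * Real.log M) - 2 * Real.log g - Real.log k₁ - Real.log k₂) ^ 0) +
              (-1 / 48) * ((k₁.divisors.card : ℝ) * (∑ p ∈ k₁.primeFactors, Real.log p ^ 2) * (k₂.divisors.card : ℝ) *
                (2 * (lam * Real.log M) - 2 * Real.log g - Real.log k₁ - Real.log k₂) ^ 3) +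
              (-1 / 48) * ((k₁.divisors.card : ℝ) * ((k₂.divisors.card : ℝ) * ∑ p ∈ k₂.primeFactors, Real.log p ^ 2) *
                (2 * (lam * Real.log M) - 2 * Real.log g - Real.log k₁ - Real.log k₂) ^ 3) +
              (-E₀₀ / 8) * ((k₁.divisors.card : ℝ) * (∑ p ∈ k₁.primeFactors, Real.log p ^ 2) * (k₂.divisors.card : ℝ) *
                (2 * (lam * Real.log M) - 2 * Real.log g - Real.log k₁ - Real.log k₂) ^ 2) +
              (-E₀₀ / 8) * ((k₁.divisors.card : ℝ) * ((k₂.divisors.card : ℝ) * ∑ p ∈ k₂.primeFactors, Real.log p ^ 2) *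
                (2 * (lam * Real.log M) - 2 * Real.log g - Real.log k₁ - Real.log k₂) ^ 2) +
              (3 * μ₂ - (E₀₁ + E₁₀) / 4) * ((k₁.divisors.card : ℝ) * (∑ p ∈ k₁.primeFactors, Real.log p ^ 2) * (k₂.divisors.card : ℝ) *
                (2 * (lam * Real.log M) - 2 * Real.log g - Real.log k₁ - Real.log k₂) ^ 1) +
              (3 * μ₂ - (E₀₁ + E₁₀) / 4) * ((k₁.divisors.card : ℝ) * ((k₂.divisors.card : ℝ) * ∑ p ∈ k₂.primeFactors, Real.log p ^ 2) *
                (2 * (lam * Real.log M) - 2 * Real.log g - Real.log k₁ - Real.log k₂) ^ 1) +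
              ((E₀₂ + E₂₀) / 4 - E₁₁) * ((k₁.divisors.card : ℝ) * (∑ p ∈ k₁.primeFactors, Real.log p ^ 2) * (k₂.divisors.card : ℝ) *
                (2 * (lam * Real.log M) - 2 * Real.log g - Real.log k₁ - Real.log k₂) ^ 0) +
              ((E₀₂ + E₂₀) / 4 - E₁₁) * ((k₁.divisors.card : ℝ) * ((k₂.divisors.card : ℝ) * ∑ p ∈ k₂.primeFactors, Real.log p ^ 2) *
                (2 * (lam * Real.log M) - 2 * Real.log g - Real.log k₁ - Real.log k₂) ^ 0) +
              3 / 16 * ((k₁.divisors.card : ℝ) * (∑ p ∈ k₁.primeFactors, Real.log p ^ 2) *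
                ((k₂.divisors.card : ℝ) * (∑ p ∈ k₂.primeFactors, Real.log p ^ 2)) *
                (2 * (lam * Real.log M) - 2 * Real.log g - Real.log k₁ - Real.log k₂) ^ 1) +
              3 * E₀₀ / 8 * ((k₁.divisors.card : ℝ) * (∑ p ∈ k₁.primeFactors, Real.log p ^ 2) *
                ((k₂.divisors.card : ℝ) * (∑ p ∈ k₂.primeFactors, Real.log p ^ 2)) *
                (2 * (lam * Real.log M) - 2 * Real.log g - Real.log k₁ - Real.log k₂) ^ 0) +
              1 / 32 * ((k₁.divisors.card : ℝ) * (3 * (∑ p ∈ k₁.primeFactors, Real.log p ^ 2) ^ 2 - 2 * ∑ p ∈ k₁.primeFactors, Real.log p ^ 4) *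
                (k₂.divisors.card : ℝ) * (2 * (lam * Real.log M) - 2 * Real.log g - Real.log k₁ - Real.log k₂) ^ 1) +
              1 / 32 * ((k₁.divisors.card : ℝ) * ((k₂.divisors.card : ℝ) *
                (3 * (∑ p ∈ k₂.primeFactors, Real.log p ^ 2) ^ 2 - 2 * ∑ p ∈ k₂.primeFactors, Real.log p ^ 4)) *
                (2 * (lam * Real.log M) - 2 * Real.log g - Real.log k₁ - Real.log k₂) ^ 1) +
              E₀₀ / 16 * ((k₁.divisors.card : ℝ) * (3 * (∑ p ∈ k₁.primeFactors, Real.log p ^ 2) ^ 2 - 2 * ∑ p ∈ k₁.primeFactors, Real.log p ^ 4) *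
                (k₂.divisors.card : ℝ) * (2 * (lam * Real.log M) - 2 * Real.log g - Real.log k₁ - Real.log k₂) ^ 0) +
              E₀₀ / 16 * ((k₁.divisors.card : ℝ) * ((k₂.divisors.card : ℝ) *
                (3 * (∑ p ∈ k₂.primeFactors, Real.log p ^ 2) ^ 2 - 2 * ∑ p ∈ k₂.primeFactors, Real.log p ^ 4)) *
                (2 * (lam * Real.log M) - 2 * Real.log g - Real.log k₁ - Real.log k₂) ^ 0)) +
      ∑ c ∈ Icc 1 ⌊M⌋₊, ∑ g ∈ Icc 1 (⌊M⌋₊ / c), (μ g : ℝ) * c *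
        ∑ k₁ ∈ Icc 1 (⌊M⌋₊ / (c * g)), ∑ k₂ ∈ Icc 1 (⌊M⌋₊ / (c * g)),
          ((μ (c * g * k₁) : ℝ) * ((psi (c * g * k₁))⁻¹ *
              P.eval (Real.log (M / ((c * g * k₁ : ℕ) : ℝ)) / Real.log M)) / ((c * g * k₁ : ℕ) : ℝ)) *
            ((μ (c * g * k₂) : ℝ) * ((psi (c * g * k₂))⁻¹ *
              P.eval (Real.log (M / ((c * g * k₂ : ℕ) : ℝ)) / Real.log M)) / ((c * g * k₂ : ℕ) : ℝ)) *
            ((k₁.divisors.card : ℝ) * (k₂.divisors.card : ℝ) *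
              (((2 * (Real.log Q - Real.log g) - Real.log k₁ - Real.log k₂) ^ 4 -
                    2 * (2 * (Real.log Q - Real.log g) - Real.log k₁ - Real.log k₂) ^ 2 *
                      ((∑ p ∈ k₁.primeFactors, Real.log p ^ 2) + ∑ p ∈ k₂.primeFactors, Real.log p ^ 2) +
                    3 * ((∑ p ∈ k₁.primeFactors, Real.log p ^ 2) + ∑ p ∈ k₂.primeFactors, Real.log p ^ 2) ^ 2 -
                    2 * ((∑ p ∈ k₁.primeFactors, Real.log p ^ 4) + ∑ p ∈ k₂.primeFactors, Real.log p ^ 4)) / 16 *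
                  (c₀₀ (((g * g * (k₁ * k₂) : ℕ) : ℝ) / Q ^ 2) -
                  (Real.log (Q ^ 2 / ((g * g * (k₁ * k₂) : ℕ) : ℝ)) / 2 + E₀₀)) +
                ((2 * (Real.log Q - Real.log g) - Real.log k₁ - Real.log k₂) ^ 3 -
                    (2 * (Real.log Q - Real.log g) - Real.log k₁ - Real.log k₂) *
                      ((∑ p ∈ k₁.primeFactors, Real.log p ^ 2) + ∑ p ∈ k₂.primeFactors, Real.log p ^ 2)) / 4 *
                  ((c₀₁ (((g * g * (k₁ * k₂) : ℕ) : ℝ) / Q ^ 2) -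
                  (-(Real.log (Q ^ 2 / ((g * g * (k₁ * k₂) : ℕ) : ℝ)) ^ 2) / 8 + E₀₁)) +
                    (c₁₀ (((g * g * (k₁ * k₂) : ℕ) : ℝ) / Q ^ 2) -
                  (-(Real.log (Q ^ 2 / ((g * g * (k₁ * k₂) : ℕ) : ℝ)) ^ 2) / 8 + E₁₀))) +
                ((2 * (Real.log Q - Real.log g) - Real.log k₁ - Real.log k₂) ^ 2 +
                    ((∑ p ∈ k₁.primeFactors, Real.log p ^ 2) + ∑ p ∈ k₂.primeFactors, Real.log p ^ 2)) / 4 *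
                  ((c₀₂ (((g * g * (k₁ * k₂) : ℕ) : ℝ) / Q ^ 2) -
                  (Real.log (Q ^ 2 / ((g * g * (k₁ * k₂) : ℕ) : ℝ)) ^ 3 / 24 + 2 * μ₂ * Real.log (Q ^ 2 / ((g * g * (k₁ * k₂) : ℕ) : ℝ)) + E₀₂)) +
                    (c₂₀ (((g * g * (k₁ * k₂) : ℕ) : ℝ) / Q ^ 2) -
                  (Real.log (Q ^ 2 / ((g * g * (k₁ * k₂) : ℕ) : ℝ)) ^ 3 / 24 + 2 * μ₂ * Real.log (Q ^ 2 / ((g * g * (k₁ * k₂) : ℕ) : ℝ)) + E₂₀))) +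
                ((2 * (Real.log Q - Real.log g) - Real.log k₁ - Real.log k₂) ^ 2 -
                    ((∑ p ∈ k₁.primeFactors, Real.log p ^ 2) + ∑ p ∈ k₂.primeFactors, Real.log p ^ 2)) *
                  (c₁₁ (((g * g * (k₁ * k₂) : ℕ) : ℝ) / Q ^ 2) -
                  (Real.log (Q ^ 2 / ((g * g * (k₁ * k₂) : ℕ) : ℝ)) ^ 3 / 24 - 2 * μ₂ * Real.log (Q ^ 2 / ((g * g * (k₁ * k₂) : ℕ) : ℝ)) + E₁₁)) +
                (2 * (Real.log Q - Real.log g) - Real.log k₁ - Real.log k₂) *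
                  ((c₁₂ (((g * g * (k₁ * k₂) : ℕ) : ℝ) / Q ^ 2) -
                  (-(Real.log (Q ^ 2 / ((g * g * (k₁ * k₂) : ℕ) : ℝ)) ^ 4) / 64 + μ₂ / 2 * Real.log (Q ^ 2 / ((g * g * (k₁ * k₂) : ℕ) : ℝ)) ^ 2 + E₁₂)) +
                    (c₂₁ (((g * g * (k₁ * k₂) : ℕ) : ℝ) / Q ^ 2) -
                  (-(Real.log (Q ^ 2 / ((g * g * (k₁ * k₂) : ℕ) : ℝ)) ^ 4) / 64 + μ₂ / 2 * Real.log (Q ^ 2 / ((g * g * (k₁ * k₂) : ℕ) : ℝ)) ^ 2 + E₂₁))) +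
                (c₂₂ (((g * g * (k₁ * k₂) : ℕ) : ℝ) / Q ^ 2) -
                  (Real.log (Q ^ 2 / ((g * g * (k₁ * k₂) : ℕ) : ℝ)) ^ 5 / 160 - μ₂ / 3 * Real.log (Q ^ 2 / ((g * g * (k₁ * k₂) : ℕ) : ℝ)) ^ 3 +
                    2 * μ₄ * Real.log (Q ^ 2 / ((g * g * (k₁ * k₂) : ℕ) : ℝ)) + E₂₂)))) := by
  rw [← selbergProd_add]
  refine Finset.sum_congr rfl fun c _ ↦ Finset.sum_congr rfl fun g hg ↦ ?_
  have hg0 : g ≠ 0 := by have := (Finset.mem_Icc.1 hg).1; omega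
  congr 1
  refine Finset.sum_congr rfl fun k₁ hk₁ ↦ Finset.sum_congr rfl fun k₂ hk₂ ↦ ?_
  have hk₁0 : k₁ ≠ 0 := by have := (Finset.mem_Icc.1 hk₁).1; omega
  have hk₂0 : k₂ ≠ 0 := by have := (Finset.mem_Icc.1 hk₂).1; omega
  rw [log_Q_sq_div_eq hQ hg0 hk₁0 hk₂0, hlam]
  congr 1
  ring

end Summit.Parity.GeneralizedHardyLittlewood.Theorems.MomentsBeyondDiagonal.DiagKernel

end
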